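import Summits.NavierStokesRegularity.FluidComputer.GateBudgetSecondIgnition
import HarnessLib

/-!
# What no tuning can beat, part 42: THE SECOND PULSE OF A LATTICE DUD MISFIRES — its phase is
# pinned to `kπ ± 0.07` exactly like the first pulse's, and at its second dousing time `T₂` at
# least `39/40` of the energy is still in the carrier

Cell `pub-fluidc`, blueprint seat bp1 (gen 33, second item, second half); same namespace and
conventions as parts 1–41 (`GateBudget*.lean`); imports part 41 (`GateBudgetSecondIgnition`, and
through it parts 38 `GateBudgetSharpRefire`, 22 `GateBudgetComb`, 16 `GateBudgetPinnedPhase`, 14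
`GateBudgetCarrierPhase`, 1 `GateBudget`). Modes `0 = a` carrier, `1 = b` clock, `2 = c` trigger,
`3 = d` transfer, `4 = ã` output; `t₋ = √(2 - 24 log K/K¹⁰)`, `t₊ = √(2 + 2/K¹⁰) + 242/K⁹`.
HONEST FRAMING (verbatim): low prior, high value-of-information experiment on Tao's machine
paradigm; NOT a claim that NS blows up. Nothing is proved about the Navier–Stokes equations.

THE POINT (SPEC-INPUT-bp1 §AN item (19b), THE SECOND PULSE'S TRANSFER, second half). Part 41
(`knob_dud_second_ignition`) re-entered part 18 at the re-light time `r₁` of a lattice dud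
(`ε = kK¹⁰ρ²`): a second dousing time `T₂ ∈ (r₁, r₁ + 242/K⁹]` with the trigger lit and the clock
pair of radius `≥ 7ε/10` on `[r₁, T₂]`, `b(r₁) ≥ 1.39ε`, `c(r₁) = ρ²/K⁹`, `b(T₂) ≤ -ε/4`,
`c(T₂) ≤ 2ρ²/K¹⁰`, `a(r₁)² ≥ 0.993`. This part reads the second pulse exactly as parts 14 and 16
read the first:
* §127 `knob_dud_second_transfer`: part 16's swing (`knob_swing_lower` with `b₁ = ε/2`,
  `γ₁ = ρ²/K⁹`, `β = ε/4`) and bracket (`knob_phase_bracket` from `s₀ = r₁`, `ϱ = 7ε/10`), read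
  as a pin by part 41's `pin_of_bracket` and bounded by part 41's `second_psi_le` and part 22's
  `teeth_psi`: THE SECOND PULSE'S PHASE IS PINNED, `|(C(T₂) - C(r₁))/ρ² - kπ| ≤ 7/100`, for ANY
  primitive `C` of the trigger; part 14's `knob_phase_tracking_d` from `r₁` (drift `2(ε + σ +
  Kã)(T₂ - r₁) ≤ 968/K⁸ ≤ 10⁻⁶`, the pulse being `≤ 242/K⁹` long) and `|sin(θ + kπ)| = |sin θ| ≤
  |θ|` give the transfer `|d(T₂)| ≤ (7/100)|a(r₁)| + |d(r₁)| + 10⁻⁶`; the energy identity at `r₁`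
  (`d² + ã² ≤ 1 - a² ≤ 7/1000`, so `|d(r₁)|, ã(r₁) ≤ 0.0837`) and the output growth give the
  output pair `d(T₂)² + ã(T₂)² ≤ 1/40`, and the identity at `T₂` (`|b| ≤ (ε + σ)T₂ ≤ 9ε`,
  `c ≤ 2ρ²/K¹⁰ ≤ ε`, `82ε² ≤ 10⁻⁵`) the carrier `a(T₂)² ≥ 39/40 - 10⁻⁵`: THE DUD MISFIRES AGAIN.

READING. The second pulse of a lattice dud is a copy of the first: pinned to a multiple of `π`
within `0.07`, it moves at most `7 %` of the carrier amplitude into the transfer mode, and after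
it `≥ 97.5 %` of the energy is still in the carrier (`≥ 99.3 %` after the first pulse, part 38).
HONEST LIMITS. (i) The bound degrades from pulse to pulse ONLY through the bookkeeping `|d(r₁)| ≤
√(1 - a(r₁)²) ≤ 0.0837`: the drain's emptying of the transfer mode on the cold window (part 26's
Riccati clock gives `|d(r₁)| = O(1/K)`) is NOT used, so an induction over pulses does not close
from this part alone (successor item (19b′)); (ii) the second cold window and a third pulse are
not treated; (iii) LATTICE members only; (iv) the budget `7/100` is part 22's (the true second
budget is `≈ π/98`); (v) `M = K¹⁰`, `K ≥ 16`, `200ε/K²⁰ ≤ ρ² ≤ 2ε/K¹⁰`, `ε² ≤ 1/(6K²⁰)`;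
(vi) nothing about Navier–Stokes.
[cite: Tao2016AveragedNS, §5.5 Theorem 5.3, (5.5), (5.6), (b-eq), (c-eq), (tcable), (energy-con)]
-/

noncomputable section

namespace Summit.NavierStokesRegularity.FluidComputer.GateBudget

open Real Set Filter Topology
open Literature.Analysis.FluidPDE.Tao2016AveragedNS

variable {K ε ρ : ℝ} {X : ℝ → Fin 5 → ℝ} {C : ℝ → ℝ}

/-! ## §127 The second pulse is pinned to `kπ ± 0.07` and misfires -/

/-- **THE SECOND PULSE OF A LATTICE DUD MISFIRES.** Same hypotheses as part 41's §126, and ANY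
primitive `C` of the trigger (`C′ = c`): there are `r₁ ∈ (t₋ + 2.8282, t₊ + 2.8542)` and
`T₂ ∈ (r₁, r₁ + 242/K⁹]` with `c(r₁) = ρ²/K⁹`, `a(r₁)² ≥ 0.993`, `b(T₂) ≤ -ε/4`,
`c(T₂) ≤ 2ρ²/K¹⁰`, the SECOND PULSE'S PHASE PINNED `|(C(T₂) - C(r₁))/ρ² - kπ| ≤ 7/100`, the transfer
`|d(T₂)| ≤ (7/100)|a(r₁)| + |d(r₁)| + 10⁻⁶`, the output pair `d(T₂)² + ã(T₂)² ≤ 1/40` and the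
carrier `a(T₂)² ≥ 39/40 - 10⁻⁵` — part 16's swing and bracket from `r₁` (part 41: `ψ₂ ≤ 7/100`),
part 14's tracking from `r₁` (drift `≤ 968/K⁸`), `|sin(θ + kπ)| ≤ |θ|`, and the energy identity
at `r₁` (`d² + ã² ≤ 7/1000`) and at `T₂` (`|b| ≤ (ε + σ)T₂`, `c ≤ 2ρ²/K¹⁰`).
[cite: Tao2016AveragedNS, §5.5 Theorem 5.3, (5.5), (5.6), (b-eq), (c-eq), (tcable), (energy-con)]
-/
theorem knob_dud_second_transfer
    (hX : ∀ t, HasDerivAt X (RotorKnob.rotorCircuit K (K ^ 10) ε ρ (X t)) t)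
    (h0 : X 0 = delayInit) (hC : ∀ t, HasDerivAt C (X t 2) t) (hK : 16 ≤ K) (hε : 0 < ε)
    (hεK : ε ^ 2 ≤ 1 / (6 * K ^ 20)) (hρ : 0 < ρ) (hlo : 200 * ε / K ^ 20 ≤ ρ ^ 2)
    (hhi : K ^ 10 * ρ ^ 2 ≤ 2 * ε) (k : ℕ) (hk : ε = k * K ^ 10 * ρ ^ 2) :
    ∃ r₁ T₂ : ℝ, √(2 - 24 * Real.log K / K ^ 10) + 28282 / 10000 < r₁ ∧
      r₁ < √(2 + 2 / K ^ 10) + 242 / K ^ 9 + 28542 / 10000 ∧ r₁ < T₂ ∧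
      T₂ - r₁ ≤ 242 / K ^ 9 ∧ X r₁ 2 = ρ ^ 2 / K ^ 9 ∧ 993 / 1000 ≤ X r₁ 0 ^ 2 ∧
      X T₂ 1 ≤ -(ε / 4) ∧ X T₂ 2 ≤ 2 * ρ ^ 2 / K ^ 10 ∧
      |(C T₂ - C r₁) / ρ ^ 2 - k * π| ≤ 7 / 100 ∧
      |X T₂ 3| ≤ 7 / 100 * |X r₁ 0| + |X r₁ 3| + 1 / 10 ^ 6 ∧
      X T₂ 3 ^ 2 + X T₂ 4 ^ 2 ≤ 1 / 40 ∧ 39 / 40 - 1 / 10 ^ 5 ≤ X T₂ 0 ^ 2 := by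
  have hK0 : 0 < K := by linarith
  have hK9 : 0 < K ^ 9 := by positivity
  have hK10 : 0 < K ^ 10 := by positivity
  have hρ2 : 0 < ρ ^ 2 := by positivity
  have hε2 : 0 < ε ^ 2 := by positivity
  have h8 : (4294967296 : ℝ) ≤ K ^ 8 := by
    have := headline_pow_floor hK 8; norm_num at this; exact this
  have h10 : (1099511627776 : ℝ) ≤ K ^ 10 := by
    have := headline_pow_floor hK 10; norm_num at this; exact this
  obtain ⟨hq1, -, -, -, -, hρK, hρε, hε1, -, -, hσ, -⟩ := refire_window_facts hK hε hεK hhi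
  obtain ⟨-, -, hlam2, -⟩ := cold_facts hK hε
  have hXf := hX
  rw [RotorKnob.rotorCircuit_eq_fiveGate] at hXf
  obtain ⟨r₁, T₂, hr1, hr2, hsT, hτ, hc, hr, hb139, hcr₁, hbT, hcT, ha1, hgrow⟩ :=
    knob_dud_second_ignition hX h0 hC hK hε hεK hρ hlo hhi k hk
  have hr₁0 : 0 ≤ r₁ := by linarith [Real.sqrt_nonneg (2 - 24 * Real.log K / K ^ 10)]
  have hτ0 : 0 ≤ T₂ - r₁ := by linarith
  have hcr0 : 0 < X r₁ 2 := hc r₁ ⟨le_rfl, hsT.le⟩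
  have hcT0 : 0 < X T₂ 2 := hc T₂ ⟨hsT.le, le_rfl⟩
  have hcT2 : X T₂ 2 ≤ 2 * ρ ^ 2 / K ^ 10 := by
    rw [show 2 * ρ ^ 2 / K ^ 10 = 2 * (1 / K ^ 10) * ρ ^ 2 by ring]
    exact hcT.trans (mul_le_mul_of_nonneg_right hlam2 hρ2.le)
  -- the swing from `r₁` (`b₁ = ε/2`, `γ₁ = ρ²/K⁹`, `β = ε/4`, `λ₀ = K⁻¹⁰ + 4e^{-K¹⁰}/K¹⁰`)
  have hη := knob_swing_lower (X := X) (ρ := ρ) (b₁ := ε / 2) (γ₁ := ρ ^ 2 / K ^ 9)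
    (by positivity) (by linarith) hcr0 hcr₁.le (by positivity : (0:ℝ) < ε / 4) hbT hcT0 hcT
  -- part 16's bracket from `r₁` with `ϱ = 7ε/10`, read as a pin by §125
  have hq : ε ^ 2 < K ^ 10 * (7 / 10 * ε) ^ 2 := by
    have hKε : 1099511627776 * ε ^ 2 ≤ K ^ 10 * ε ^ 2 := mul_le_mul_of_nonneg_right h10 hε2.le
    rw [show K ^ 10 * (7 / 10 * ε) ^ 2 = 49 / 100 * (K ^ 10 * ε ^ 2) by ring]
    linarith only [hKε, hε2]
  obtain ⟨hlo', hhi'⟩ := knob_phase_bracket hX h0 hε hρ hK10 hC hsT.le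
    (by positivity : (0:ℝ) < 7 / 10 * ε) hq hc hr hη
  have hw : ε / (K ^ 10 * ρ ^ 2) = k := by
    rw [div_eq_iff (by positivity), hk]; ring
  rw [hw] at hlo' hhi'
  have hηpos : 0 ≤ arctan (ρ ^ 2 / K ^ 9 / (ε / 2))
      + arctan ((1 / K ^ 10 + 4 * exp (-K ^ 10) / K ^ 10) * ρ ^ 2 / (ε / 4)) :=
    add_nonneg (Real.arctan_nonneg.2 (by positivity)) (Real.arctan_nonneg.2 (by positivity))
  have hq0 : 0 ≤ ε ^ 2 / (K ^ 10 * (7 / 10 * ε) ^ 2) := by positivity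
  have hq1' : ε ^ 2 / (K ^ 10 * (7 / 10 * ε) ^ 2) < 1 := (div_lt_one (by positivity)).2 hq
  have hpin := pin_of_bracket (Nat.cast_nonneg k) hηpos (by positivity) hq0 hq1' hlo' hhi'
  have h9 : (68719476736 : ℝ) ≤ K ^ 9 := by
    have := headline_pow_floor hK 9; norm_num at this; exact this
  have h242 : (242 : ℝ) / K ^ 9 ≤ 242 / 68719476736 :=
    div_le_div_of_nonneg_left (by norm_num) (by norm_num) h9
  have hψ := (second_psi_le k hk hε hρ hK hτ).trans
    (teeth_psi hK hε hlo (by positivity : (0:ℝ) ≤ 242 / K ^ 9) (by linarith))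
  have hpin7 : |(C T₂ - C r₁) / ρ ^ 2 - k * π| ≤ 7 / 100 := hpin.trans hψ
  -- part 14's tracking of the transfer mode from `r₁`; drift `≤ 968/K⁸ ≤ 10⁻⁶`
  have htd := knob_phase_tracking_d hX h0 hC hε.le hK0.le hr₁0 hsT.le
  set Φ := (C T₂ - C r₁) / ρ ^ 2 with hΦ
  have heT0 : 0 ≤ X T₂ 4 := e_nonneg hXf h0 hK0.le (by linarith)
  have heT1 : X T₂ 4 ≤ 1 := (le_abs_self _).trans (traj_abs_le_one hXf h0 T₂ 4)
  have hL : ε + ρ ^ 2 * exp (-K ^ 10) + K * X T₂ 4 ≤ 2 * K := by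
    have h1 : K * X T₂ 4 ≤ K * 1 := mul_le_mul_of_nonneg_left heT1 hK0.le
    have h2 : ρ ^ 2 * exp (-K ^ 10) ≤ 1 := by
      have : ε * (1 / K ^ 10) ≤ 1 * 1 :=
        mul_le_mul hε1 (by linarith only [hq1]) (by positivity) zero_le_one
      linarith only [hσ, this]
    linarith only [h1, h2, hε1, hK]
  have hdrift : 2 * ((ε + ρ ^ 2 * exp (-K ^ 10) + K * X T₂ 4) * (T₂ - r₁)) ≤ 1 / 10 ^ 6 := by
    have h1 : (ε + ρ ^ 2 * exp (-K ^ 10) + K * X T₂ 4) * (T₂ - r₁) ≤ 2 * K * (242 / K ^ 9) :=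
      mul_le_mul hL hτ hτ0 (by positivity)
    have h2 : 2 * K * (242 / K ^ 9) = 484 / K ^ 8 := by
      field_simp
      norm_num
    have h3 : (484 : ℝ) / K ^ 8 ≤ 484 / 4294967296 :=
      div_le_div_of_nonneg_left (by norm_num) (by norm_num) h8
    linarith only [h1, h2, h3, htd]
  -- `|sin Φ| ≤ |Φ - kπ| ≤ 7/100`, `|cos Φ| ≤ 1`, `|a(r₁)| ≤ 1`
  have hsin : |sin Φ| ≤ 7 / 100 := by
    have hΘ : Φ = (Φ - k * π) + k * π := by ring
    rw [hΘ, sin_add_nat_mul_pi, abs_mul, abs_pow, abs_neg, abs_one, one_pow, one_mul]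
    exact abs_sin_le_abs.trans hpin7
  have hd2 : |X T₂ 3| ≤ 7 / 100 * |X r₁ 0| + |X r₁ 3| + 1 / 10 ^ 6 := by
    have h1 := abs_sub_abs_le_abs_sub (X T₂ 3) (sin Φ * X r₁ 0 + cos Φ * X r₁ 3)
    have h2 := abs_add_le (sin Φ * X r₁ 0) (cos Φ * X r₁ 3)
    rw [abs_mul, abs_mul] at h2
    have h3 : |sin Φ| * |X r₁ 0| ≤ 7 / 100 * |X r₁ 0| :=
      mul_le_mul_of_nonneg_right hsin (abs_nonneg _)
    have h4 : |cos Φ| * |X r₁ 3| ≤ |X r₁ 3| :=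
      mul_le_of_le_one_left (abs_nonneg _) (abs_cos_le_one _)
    linarith only [h1, h2, h3, h4, htd, hdrift]
  -- the energy identity at `r₁` and at `T₂`
  have hE1 : X r₁ 0 ^ 2 + X r₁ 1 ^ 2 + X r₁ 2 ^ 2 + X r₁ 3 ^ 2 + X r₁ 4 ^ 2 = 1 := by
    simpa [energy, Fin.sum_univ_five] using energy_init hXf h0 r₁
  have hE2 : X T₂ 0 ^ 2 + X T₂ 1 ^ 2 + X T₂ 2 ^ 2 + X T₂ 3 ^ 2 + X T₂ 4 ^ 2 = 1 := by
    simpa [energy, Fin.sum_univ_five] using energy_init hXf h0 T₂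
  have ha10 : |X r₁ 0| ≤ 1 := traj_abs_le_one hXf h0 r₁ 0
  have he10 : 0 ≤ X r₁ 4 := e_nonneg hXf h0 hK0.le hr₁0
  have hxy : |X r₁ 3| ^ 2 + X r₁ 4 ^ 2 ≤ 7 / 1000 := by
    rw [sq_abs]; linarith only [hE1, ha1, sq_nonneg (X r₁ 1), sq_nonneg (X r₁ 2)]
  have hx : |X r₁ 3| ≤ 837 / 10000 :=
    abs_le_of_sq_le_sq (by rw [sq_abs] at hxy; linarith only [hxy, sq_nonneg (X r₁ 4)])
      (by norm_num)
  have hy : X r₁ 4 ≤ 837 / 10000 := (le_abs_self _).trans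
    (abs_le_of_sq_le_sq (by linarith only [hxy, sq_nonneg (|X r₁ 3|)]) (by norm_num))
  have hd2' : |X T₂ 3| ≤ 7 / 100 + |X r₁ 3| + 1 / 10 ^ 6 := by
    have : 7 / 100 * |X r₁ 0| ≤ 7 / 100 := mul_le_of_le_one_right (by norm_num) ha10
    linarith only [hd2, this]
  have hdsq : X T₂ 3 ^ 2 ≤ (7 / 100 + |X r₁ 3| + 1 / 10 ^ 6) ^ 2 := by
    have h := pow_le_pow_left₀ (abs_nonneg _) hd2' 2; rwa [sq_abs] at h
  have heT : X T₂ 4 ≤ X r₁ 4 + 1 / 10 ^ 7 := by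
    have h1 : K * (T₂ - r₁) ≤ K * (242 / K ^ 9) := mul_le_mul_of_nonneg_left hτ hK0.le
    have h2 : K * (242 / K ^ 9) = 242 / K ^ 8 := by
      field_simp
    have h3 : (242 : ℝ) / K ^ 8 ≤ 242 / 4294967296 :=
      div_le_div_of_nonneg_left (by norm_num) (by norm_num) h8
    linarith only [hgrow, h1, h2, h3]
  have hesq : X T₂ 4 ^ 2 ≤ (X r₁ 4 + 1 / 10 ^ 7) ^ 2 := pow_le_pow_left₀ heT0 heT 2
  have hpair : X T₂ 3 ^ 2 + X T₂ 4 ^ 2 ≤ 1 / 40 := by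
    have h14 : 14 / 100 * |X r₁ 3| ≤ 14 / 100 * (837 / 10000) :=
      mul_le_mul_of_nonneg_left hx (by norm_num)
    have h5 : 2 / 10 ^ 7 * X r₁ 4 ≤ 2 / 10 ^ 7 * (837 / 10000) :=
      mul_le_mul_of_nonneg_left hy (by norm_num)
    linarith only [hxy, h14, h5, abs_nonneg (X r₁ 3), he10, hdsq, hesq]
  -- `b(T₂)² + c(T₂)² ≤ 10⁻⁵`: `|b(T₂)| ≤ (ε + σ)T₂ ≤ 1.01ε·4.5`, `c(T₂) ≤ 2ρ²/K¹⁰ ≤ ε`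
  have hbT2 : X T₂ 1 ^ 2 + X T₂ 2 ^ 2 ≤ 1 / 10 ^ 5 := by
    have hb := abs_b_le hXf h0 hε.le (by positivity) (t := T₂) (by linarith)
    have hσ1 : ρ ^ 2 * exp (-K ^ 10) ≤ ε := by
      have : ε * (1 / K ^ 10) ≤ ε * 1 :=
        mul_le_mul_of_nonneg_left (by linarith only [hq1]) hε.le
      linarith only [hσ, this]
    have hT45 : T₂ ≤ 45 / 10 := by
      have hsq : √(2 + 2 / K ^ 10) ≤ 3 / 2 := by
        have h2 : 2 / K ^ 10 ≤ 2 / 1099511627776 :=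
          div_le_div_of_nonneg_left (by norm_num) (by norm_num) h10
        exact (Real.sqrt_le_left (by norm_num)).2 (by linarith only [h2])
      linarith only [hr2, hτ, hsq, h242]
    have hb9 : |X T₂ 1| ≤ 9 * ε := by
      have : (ε + ρ ^ 2 * exp (-K ^ 10)) * T₂ ≤ (2 * ε) * (45 / 10) :=
        mul_le_mul (by linarith only [hσ1]) hT45 (by linarith only [hsT, hr₁0])
          (by positivity)
      linarith only [hb, this]
    have hb81 : X T₂ 1 ^ 2 ≤ (9 * ε) ^ 2 := by
      have h := pow_le_pow_left₀ (abs_nonneg _) hb9 2; rwa [sq_abs] at h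
    have hc2 : X T₂ 2 ≤ ε := by
      have h1 : 2 * (1 / K ^ 10) * ρ ^ 2 ≤ 2 * (1 / 1099511627776) * ρ ^ 2 :=
        mul_le_mul_of_nonneg_right (mul_le_mul_of_nonneg_left hq1 (by norm_num)) hρ2.le
      linarith only [h1, hcT.trans (mul_le_mul_of_nonneg_right hlam2 hρ2.le), hρε, hρ2]
    have hc2' : X T₂ 2 ^ 2 ≤ ε ^ 2 := pow_le_pow_left₀ hcT0.le hc2 2
    have hK20 : ε ^ 2 ≤ 1 / (6 * (1099511627776 * 1099511627776)) := by
      have : (1099511627776 : ℝ) * 1099511627776 ≤ K ^ 20 := by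
        rw [show K ^ 20 = K ^ 10 * K ^ 10 by ring]
        exact mul_le_mul h10 h10 (by norm_num) hK10.le
      exact hεK.trans
        (div_le_div_of_nonneg_left (by norm_num) (by positivity) (by linarith only [this]))
    linarith only [hb81, hc2', hK20]
  refine ⟨r₁, T₂, hr1, hr2, hsT, hτ, hcr₁, ha1, hbT, hcT2, hpin7, hd2, hpair, ?_⟩
  linarith only [hE2, hpair, hbT2]

end Summit.NavierStokesRegularity.FluidComputer.GateBudget
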